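import Summits.AtomisticToContinuum.Crystallization.Theorems.FrustratedLawDichotomyCellArithLipNash

/-!
# FrustratedLawDichotomy · crux `AperiodicFrustratedLawGap` (stmt-AtomisticToContinuum-27623) — CELL-ARITH «NASH-LIP», the CENTRE evaluation:
# the identity-metric pair term as ONE integer matrix–vector product with a certified rounding error (decomp-a2c hand-1 g53; r1796 (B)
# «centre reading ≈ 132 k pairs × 9 ℤ mult-adds»)

At the box centre `G = 1` the linearised pair force in label coordinates is EXACTLY `linLab 1 a ω = ψ(t₀)·ω + 2ψ′(t₀)(a·ω)·a`,
`t₀ = |a|²`, `a = (hn/hd)·z`, `ω = w/D`.  With POINT readings `PL ≤ S·ψ(t₀) ≤ PH`, `P1L ≤ S·ψ′(t₀) ≤ P1H` (once per class, any width)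
the K-file evaluates per pair the integer vector
  `ctrPairIF = (PL·hd²·w_i + 2·P1L·hn²·z_i·(z·w))_i`   (scale `Σ_c := S·D·hd²`; ≈ 14 `ℤ` operations, no branches)
and books ONCE the error `|ctrPairIF_i − Σ_c·(linLab 1 a ω) i| ≤ (PH − PL)·hd²·|w_i| + (P1H − P1L)·2hn²·|z_i|·|z·w|` — whose sum over a
label's pairs is a per-label (or, cruder, per-cell) integer the K-file folds alongside.
* `ctrPairIF`, ★ `ctrPairIF_err` (the error bound), `ctrLeadIF` + `ctrLeadIF_err` (the lead term `ψ(t₀)·a i` at scale `S·D·ed?` — here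
  `Σ_c` with `D` carried for uniformity: `Σ_c·ψ(t₀)·a_i = S ψ·D·hd·hn·z_i`).
Together with `…CellArithLipNash` (`nash_centre_lip_coord`, `norm_posL_le_of_centre_lip`) this is the whole centre-plus-slack hnn route.
Computable `def`s over `ℤ` + soundness; imports `…CellArithLipNash`; 0 sorry.  Tags: [folklore].
-/

namespace Summit.AtomisticToContinuum.Crystallization.Theorems.FrustratedLawDichotomyCellArithCentre

open scoped BigOperators
open Summit.AtomisticToContinuum.Crystallization.Theorems.FrustratedLawDichotomyCoherentFloorAlgebra (psiT psiT1)
open Summit.AtomisticToContinuum.Crystallization.Theorems.FrustratedLawDichotomyCellMetric (gram linLab)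
open Summit.AtomisticToContinuum.Crystallization.Theorems.FrustratedLawDichotomyCellArithLip (gram_one)

/-- ★ the CENTRE pair vector at scale `Σ_c = S·D·hd²`: coordinate `i` is `PL·hd²·w_i + 2·P1L·hn²·z_i·(z·w)` (flat integer arguments). [folklore] -/
def ctrPairIF (PL P1L hn hd z0 z1 z2 w0 w1 w2 : ℤ) : ℤ × ℤ × ℤ :=
  let d := z0 * w0 + z1 * w1 + z2 * w2
  let k := PL * hd ^ 2
  let c := 2 * P1L * hn ^ 2 * d
  (k * w0 + c * z0, k * w1 + c * z1, k * w2 + c * z2)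

/-- the CENTRE lead term at scale `Σ_c`: `PL·D·hd·hn·z_i` (for `ψ(t₀)·a i`). [folklore] -/
def ctrLeadIF (PL D hn hd zi : ℤ) : ℤ := PL * D * hd * hn * zi

section Err

variable {S D hn hd PL PH P1L P1H : ℤ} {z w : Fin 3 → ℤ} {a ω : Fin 3 → ℝ}

/-- the exact identity-metric coordinate: `Σ_c·(linLab 1 a ω) i = (S·ψ(t₀))·hd²·w_i + 2·(S·ψ′(t₀))·hn²·z_i·(z·w)`. -/
theorem linLab_one_coord (hD : D ≠ 0) (hhd : hd ≠ 0) (ha : ∀ j, a j = (hn : ℝ) / (hd : ℝ) * (z j : ℝ))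
    (hω : ∀ j, ω j = (w j : ℝ) / (D : ℝ)) (i : Fin 3) :
    ((S * D * hd ^ 2 : ℤ) : ℝ) * linLab 1 a ω i
      = (S * psiT (gram 1 a a)) * hd ^ 2 * (w i : ℝ)
        + 2 * (S * psiT1 (gram 1 a a)) * hn ^ 2 * (z i : ℝ) * ((z 0 * w 0 + z 1 * w 1 + z 2 * w 2 : ℤ) : ℝ) := by
  have hD' : (D : ℝ) ≠ 0 := by exact_mod_cast hD
  have hhd' : (hd : ℝ) ≠ 0 := by exact_mod_cast hhd
  have ed : gram 1 a ω = (hn : ℝ) / hd / D * ((z 0 * w 0 + z 1 * w 1 + z 2 * w 2 : ℤ) : ℝ) := by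
    rw [gram_one]; simp only [Fin.sum_univ_three, ha, hω]; push_cast; field_simp
  simp only [linLab, Pi.add_apply, Pi.smul_apply, smul_eq_mul]
  rw [ed, ha i, hω i]; push_cast
  field_simp

/-- ★ THE CENTRE ERROR: with point readings `PL ≤ S·ψ(g_1(a,a)) ≤ PH`, `P1L ≤ S·ψ′(g_1(a,a)) ≤ P1H`,
`|ctrPairIF_i − Σ_c·(linLab 1 a ω) i| ≤ (PH − PL)·hd²·|w_i| + (P1H − P1L)·2hn²·|z_i|·|z·w|` for `i = 0, 1, 2`. [folklore] -/
theorem ctrPairIF_err (hD : D ≠ 0) (hhd : hd ≠ 0) (ha : ∀ j, a j = (hn : ℝ) / (hd : ℝ) * (z j : ℝ))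
    (hω : ∀ j, ω j = (w j : ℝ) / (D : ℝ)) (hPL : (PL : ℝ) ≤ S * psiT (gram 1 a a)) (hPH : S * psiT (gram 1 a a) ≤ (PH : ℝ))
    (hP1L : (P1L : ℝ) ≤ S * psiT1 (gram 1 a a)) (hP1H : S * psiT1 (gram 1 a a) ≤ (P1H : ℝ)) :
    let C := ctrPairIF PL P1L hn hd (z 0) (z 1) (z 2) (w 0) (w 1) (w 2)
    let d : ℤ := z 0 * w 0 + z 1 * w 1 + z 2 * w 2
    let E : Fin 3 → ℝ := fun i => ((PH - PL : ℤ) : ℝ) * hd ^ 2 * |(w i : ℝ)| + ((P1H - P1L : ℤ) : ℝ) * (2 * hn ^ 2 * |(z i : ℝ)| * |(d : ℝ)|)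
    |(C.1 : ℝ) - ((S * D * hd ^ 2 : ℤ) : ℝ) * linLab 1 a ω 0| ≤ E 0
      ∧ |(C.2.1 : ℝ) - ((S * D * hd ^ 2 : ℤ) : ℝ) * linLab 1 a ω 1| ≤ E 1
      ∧ |(C.2.2 : ℝ) - ((S * D * hd ^ 2 : ℤ) : ℝ) * linLab 1 a ω 2| ≤ E 2 := by
  dsimp only
  have key : ∀ i : Fin 3,
      |((PL * hd ^ 2 * w i + 2 * P1L * hn ^ 2 * (z 0 * w 0 + z 1 * w 1 + z 2 * w 2) * z i : ℤ) : ℝ)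
          - ((S * D * hd ^ 2 : ℤ) : ℝ) * linLab 1 a ω i|
        ≤ ((PH - PL : ℤ) : ℝ) * hd ^ 2 * |(w i : ℝ)|
          + ((P1H - P1L : ℤ) : ℝ) * (2 * hn ^ 2 * |(z i : ℝ)| * |((z 0 * w 0 + z 1 * w 1 + z 2 * w 2 : ℤ) : ℝ)|) := by
    intro i
    rw [linLab_one_coord (S := S) hD hhd ha hω i]
    push_cast
    generalize hdd : ((z 0 : ℝ) * (w 0 : ℝ) + (z 1 : ℝ) * (w 1 : ℝ) + (z 2 : ℝ) * (w 2 : ℝ)) = dd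
    generalize hψ0 : (S : ℝ) * psiT (gram 1 a a) = ψ0 at hPL hPH
    generalize hψ1 : (S : ℝ) * psiT1 (gram 1 a a) = ψ1 at hP1L hP1H
    have e : (PL : ℝ) * (hd : ℝ) ^ 2 * (w i : ℝ) + 2 * (P1L : ℝ) * (hn : ℝ) ^ 2 * dd * (z i : ℝ)
        - (ψ0 * (hd : ℝ) ^ 2 * (w i : ℝ) + 2 * ψ1 * (hn : ℝ) ^ 2 * (z i : ℝ) * dd)
        = ((PL : ℝ) - ψ0) * ((hd : ℝ) ^ 2 * (w i : ℝ)) + ((P1L : ℝ) - ψ1) * (2 * (hn : ℝ) ^ 2 * (z i : ℝ) * dd) := by ring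
    rw [e]
    refine (abs_add_le _ _).trans (add_le_add ?_ ?_)
    · rw [abs_mul, abs_mul, abs_of_nonneg (by positivity : (0 : ℝ) ≤ (hd : ℝ) ^ 2)]
      have h1 : |(PL : ℝ) - ψ0| ≤ (PH : ℝ) - PL := by rw [abs_sub_comm, abs_of_nonneg (by linarith)]; linarith
      calc |(PL : ℝ) - ψ0| * ((hd : ℝ) ^ 2 * |(w i : ℝ)|) ≤ ((PH : ℝ) - PL) * ((hd : ℝ) ^ 2 * |(w i : ℝ)|) :=
            mul_le_mul_of_nonneg_right h1 (by positivity)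
        _ = ((PH : ℝ) - PL) * (hd : ℝ) ^ 2 * |(w i : ℝ)| := by ring
    · rw [abs_mul]
      have h2 : |(P1L : ℝ) - ψ1| ≤ (P1H : ℝ) - P1L := by rw [abs_sub_comm, abs_of_nonneg (by linarith)]; linarith
      have h3 : |2 * (hn : ℝ) ^ 2 * (z i : ℝ) * dd| = 2 * (hn : ℝ) ^ 2 * |(z i : ℝ)| * |dd| := by
        rw [abs_mul, abs_mul, abs_of_nonneg (by positivity : (0 : ℝ) ≤ 2 * (hn : ℝ) ^ 2)]
      rw [h3]
      exact mul_le_mul_of_nonneg_right h2 (by positivity)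
  unfold ctrPairIF
  refine ⟨?_, ?_, ?_⟩
  · have := key 0; push_cast at this ⊢; simpa [mul_comm, mul_assoc, mul_left_comm] using this
  · have := key 1; push_cast at this ⊢; simpa [mul_comm, mul_assoc, mul_left_comm] using this
  · have := key 2; push_cast at this ⊢; simpa [mul_comm, mul_assoc, mul_left_comm] using this

/-- ★ the lead term's centre error: `|ctrLeadIF − (S·D·hd²)·(ψ(g_1(a,a))·a) i| ≤ (PH − PL)·D·hd·|hn|·|z_i|`
(`0 < D`, `0 < hd`). [folklore] -/
theorem ctrLeadIF_err (hD : 0 < D) (hhd : 0 < hd) (ha : ∀ j, a j = (hn : ℝ) / (hd : ℝ) * (z j : ℝ)) (i : Fin 3)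
    (hPL : (PL : ℝ) ≤ S * psiT (gram 1 a a)) (hPH : S * psiT (gram 1 a a) ≤ (PH : ℝ)) :
    |((ctrLeadIF PL D hn hd (z i) : ℤ) : ℝ) - ((S * D * hd ^ 2 : ℤ) : ℝ) * (psiT (gram 1 a a) • a) i|
      ≤ ((PH - PL : ℤ) : ℝ) * (D * hd * |(hn : ℝ)| * |(z i : ℝ)|) := by
  have hD' : (0 : ℝ) < D := by exact_mod_cast hD
  have hhd' : (0 : ℝ) < hd := by exact_mod_cast hhd
  set ψ0 := S * psiT (gram 1 a a) with hψ0
  have e : ((S * D * hd ^ 2 : ℤ) : ℝ) * (psiT (gram 1 a a) • a) i = ψ0 * (D * hd * hn * (z i : ℝ)) := by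
    simp only [Pi.smul_apply, smul_eq_mul]; rw [ha i]; push_cast; field_simp; ring
  rw [e]; unfold ctrLeadIF; push_cast
  have e2 : (PL : ℝ) * D * hd * hn * (z i : ℝ) - ψ0 * (D * hd * hn * (z i : ℝ)) = ((PL : ℝ) - ψ0) * (D * hd * hn * (z i : ℝ)) := by ring
  rw [e2, abs_mul]
  have h1 : |(PL : ℝ) - ψ0| ≤ (PH : ℝ) - PL := by rw [abs_sub_comm, abs_of_nonneg (by linarith)]; linarith
  have h2 : |(D : ℝ) * hd * hn * (z i : ℝ)| = D * hd * |(hn : ℝ)| * |(z i : ℝ)| := by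
    rw [abs_mul, abs_mul, abs_mul, abs_of_pos hD', abs_of_pos hhd']
  rw [h2]
  exact mul_le_mul_of_nonneg_right h1 (by positivity)

end Err

end Summit.AtomisticToContinuum.Crystallization.Theorems.FrustratedLawDichotomyCellArithCentre
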